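import Mathlib.GroupTheory.SpecificGroups.Dihedral
import Literature.Combinatorics.Additive.TripleProductProperty
import Summits.MatrixMultiplication.OmegaCensus.SmallGroupTPPVolumes
import HarnessLib

/-!
# TPP capacity is strictly supermultiplicative: `β(C₅ × D₁₀) ≥ 64 > 60 = |C₅| · β(D₁₀)`

ω-census, family (b3).  Framing: lottery ticket; floor = certified bounds/negative ranges.

For a direct product `β(G₁ × G₂) ≥ β(G₁) β(G₂)` (product of TPP triples, `tpp_product`), and for every
example computed by the census with CYCLIC index-2 subgroup `C × ℤ_n` the capacity of `C × D_{2n}` equals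
`|C| · β(D_{2n})` (`C₃×D₈, C₄×D₆, C₃×D₁₀, C₅×D₆, C₅×D₈, C₄×D₁₀, C₃×D₁₄`: kit j095343/j100464).  This file certifies
that equality FAILS in general: `C₅ × D₁₀` (`Multiplicative (ZMod 5) × DihedralGroup 5`, order 50, abelian
subgroup `ℤ₅ × ℤ₅` of index 2, not cyclic) contains a TPP triple of type `(4,4,4)` (`c5_d10_tpp_444`, found by
kissat in kit j100464 and re-found by local search; kernel `decide`), so `β(C₅ × D₁₀) ≥ 64`, while
`β(D₁₀) = 12` (`dihedral10_tpp_volume_le_twelve`, gen 1) and `β(C₅) = 5`, product `60`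
(`beta_c5_d10_gt_product`).  (`64 = (8·25 − 8)/3` is the eight-vertex-constraint ceiling for `|A| = 25`, although
`σ = (1, −1)` is not inversion here.)
-/

namespace Summit.MatrixMultiplication.OmegaCensus

open Literature.Combinatorics.Additive Finset

/-- **A `(4,4,4)` TPP triple in `C₅ × D₁₀`** (volume `64`). [folklore] -/
theorem c5_d10_tpp_444 :
    TripleProductProperty
      ({(Multiplicative.ofAdd (0 : ZMod 5), DihedralGroup.r (0 : ZMod 5)),
        (Multiplicative.ofAdd (4 : ZMod 5), DihedralGroup.r (1 : ZMod 5)),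
        (Multiplicative.ofAdd (0 : ZMod 5), DihedralGroup.sr (3 : ZMod 5)),
        (Multiplicative.ofAdd (4 : ZMod 5), DihedralGroup.sr (2 : ZMod 5))} :
        Finset (Multiplicative (ZMod 5) × DihedralGroup 5))
      ({(Multiplicative.ofAdd (0 : ZMod 5), DihedralGroup.r (0 : ZMod 5)),
        (Multiplicative.ofAdd (3 : ZMod 5), DihedralGroup.r (3 : ZMod 5)),
        (Multiplicative.ofAdd (2 : ZMod 5), DihedralGroup.r (2 : ZMod 5)),
        (Multiplicative.ofAdd (1 : ZMod 5), DihedralGroup.r (1 : ZMod 5))} :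
        Finset (Multiplicative (ZMod 5) × DihedralGroup 5))
      ({(Multiplicative.ofAdd (2 : ZMod 5), DihedralGroup.sr (3 : ZMod 5)),
        (Multiplicative.ofAdd (0 : ZMod 5), DihedralGroup.r (1 : ZMod 5)),
        (Multiplicative.ofAdd (2 : ZMod 5), DihedralGroup.r (4 : ZMod 5)),
        (Multiplicative.ofAdd (0 : ZMod 5), DihedralGroup.sr (1 : ZMod 5))} :
        Finset (Multiplicative (ZMod 5) × DihedralGroup 5)) := by
  unfold TripleProductProperty; decide +kernel

/-- **`β(C₅ × D₁₀) ≥ 64`.** [folklore] -/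
theorem beta_c5_d10_ge_64 :
    ∃ S T U : Finset (Multiplicative (ZMod 5) × DihedralGroup 5), TripleProductProperty S T U ∧
      S.card * T.card * U.card = 64 :=
  ⟨_, _, _, c5_d10_tpp_444, by decide⟩

/-- **Strict supermultiplicativity**: a TPP triple of `C₅ × D₁₀` has volume `64`, exceeding
`|C₅| · β(D₁₀) = 5 · 12 = 60` (every TPP triple of `D₁₀` has volume `≤ 12`, and every TPP triple of the abelian
`C₅` trivially has volume `≤ 5 = |C₅|`). [folklore] -/
theorem beta_c5_d10_gt_product :
    (∃ S T U : Finset (Multiplicative (ZMod 5) × DihedralGroup 5), TripleProductProperty S T U ∧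
      S.card * T.card * U.card = 64) ∧
    (∀ S T U : Finset (DihedralGroup 5), TripleProductProperty S T U → S.card * T.card * U.card ≤ 12) ∧
    Fintype.card (Multiplicative (ZMod 5)) * 12 < 64 :=
  ⟨beta_c5_d10_ge_64, dihedral10_tpp_volume_le_twelve, by rw [Fintype.card_multiplicative, ZMod.card]; norm_num⟩

end Summit.MatrixMultiplication.OmegaCensus
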